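import Summits.NavierStokesRegularity.NavierStokesRegularity.Theses.AxisymmetricExtremality
import Summits.NavierStokesRegularity.NavierStokesRegularity.Theorems.AxisymmetricExtremalityAxisymmetricKatoGlobalStubSeregin2020TypeIILemma22AxisCutoffTest
import Summits.NavierStokesRegularity.NavierStokesRegularity.Theorems.AxisymmetricExtremalityAxisymmetricKatoGlobalStubSeregin2020TypeIILemma22InvCylRadius
import Literature.Analysis.FluidPDE.CylindricalIntegration
import Literature.Analysis.FluidPDE.KNSSSwirlTransport
import Mathlib.MeasureTheory.Integral.MeanInequalities
import HarnessLib

/-!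
# Seregin 2020, Lemma 2.2 (after Nazarov–Uraltseva 2012): the drift–cut-off commutator
# `∫∫ Φ η U·∇ψ_ε dx dt → 0` for a drift `U ∈ L³`

Helper toward the stub `stub_seregin2020TypeII` of the crux `AxisymmetricKatoGlobal` (= the named
fact `Literature.Analysis.FluidPDE.Seregin2020_axisymmetricSingularPoint_typeII`, G. Seregin,
Anal. Math. Phys. 10 (2020) Paper 46 = arXiv:2006.04140, Thm 2.1; remaining ingredient Lemma 2.2
in the corrected rendering `hWH′`). When the pointwise inequality (2.12) is tested with `η ψ_ε`
(`ψ_ε` the axis cut-off) and the drift `u` is moved onto the test function, the term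
`∫∫ Φ η u·∇ψ_ε` appears; it carries no axis contribution (this is the boundary term
`∫_{ϱ=ε} Φ η u·n dσ` of the sharp cut-off) and tends to `0` because `|∇ψ_ε| ≤ 2C_T/ϱ` lives on
`{ϱ ≤ ε}` while `|u|/ϱ ∈ L¹_loc` for `u ∈ L³_loc` (`ϱ^{-3/2} ∈ L¹_loc`, the sibling
`…Lemma22InvCylRadius`). In the rendering, `u` enters (2.12) through its pointwise representative
`U`, continuous off the axis and equal to `u` a.e.; this file proves the limit for such `U`:

* `aestronglyMeasurable_indicator_of_continuousOn_offAxis` — `U` continuous on `W ∩ {ϱ ≠ 0}`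
  (`W` open) is a.e.-strongly measurable on every compact `K ⊆ W` (the axis is null);
* `integrableOn_inv_cylRadius_snd` — `1/ϱ` is integrable on compact subsets of `ℝ × ℝ³`;
* `integrable_norm_div_cylRadius_of_lintegral_cube` — `∫_K ‖U‖³ < ∞` ⟹ `‖U‖/ϱ ∈ L¹(K)`
  (Hölder `(3, 3/2)` and `∫_{B} ϱ^{-3/2} ≤ C r^{3/2}`), and `‖U‖ ∈ L¹(K)`;
* `integrable_clm_apply_drift`, `integrable_mul_axisDrift_apply`,
  `integrable_mul_axisDrift_axisCutoff` — integrability on `ℝ × ℝ³` of the drift integrands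
  `L(z)[U(z)]` (`L` bounded, vanishing off `K`, `‖U‖ ∈ L¹(K)`), `Φ (2/ϱ) D(z)[e_ϱ]` and
  `F (2/ϱ)∂_ϱψ_ε` (`1/ϱ ∈ L¹(K)`);
* `tendsto_integral_driftCommutator` — for `G` bounded, a.e.-strongly measurable, vanishing off
  `K`, and `‖U‖/ϱ ∈ L¹(K)`: `∫∫ G · Dψ_ε[U] → 0` as `ε → 0⁺` (dominated convergence with the
  `ε`-uniform majorant `2C_T M ‖U‖/ϱ · 1_K`; `Dψ_ε → 0` pointwise off the axis).

## References

* G. Seregin, Anal. Math. Phys. 10 (2020), Paper 46 = arXiv:2006.04140, proof of Lemma 2.2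
  (arXiv p. 8). [Seregin2020]
* A. I. Nazarov, N. N. Uraltseva, St. Petersburg Math. J. 23 (2012) 93–115 = arXiv:1011.1888,
  §4, (4.5) and the drift class `v ∈ L_{q,ℓ}`. [NazarovUraltseva2012]
-/

-- the problem directory repeats the summit name (D-0017); core's `dupNamespace` linter fires
set_option linter.dupNamespace false

noncomputable section

open MeasureTheory Set Function Filter Topology TopologicalSpace Metric WithLp
open scoped NNReal ENNReal InnerProductSpace RealInnerProductSpace

namespace Summit.NavierStokesRegularity.NavierStokesRegularity.Theorems.AxisymmetricKatoGlobal.EulerScaling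

open Literature.Analysis.FluidPDE Literature.Analysis.FluidPDE.Seregin2020

/-! ### Measurability of the drift representative -/

/-- **A field continuous off the axis is measurable on compact sets.** If `U : ℝ → ℝ³ → ℝ³` is
continuous on `W ∩ {ϱ ≠ 0}` for an open `W ⊆ ℝ × ℝ³` and `K ⊆ W` is compact, then
`1_K · U` is a.e.-strongly measurable on `ℝ × ℝ³` (the axis `ℝ × {x' = 0}` is Lebesgue-null).
[folklore] -/
theorem aestronglyMeasurable_indicator_of_continuousOn_offAxis {W K : Set (ℝ × EuclideanSpace ℝ (Fin 3))}
    (hW : IsOpen W) (hK : IsCompact K) (hKW : K ⊆ W) {U : ℝ → EuclideanSpace ℝ (Fin 3) → EuclideanSpace ℝ (Fin 3)}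
    (hU : ContinuousOn (uncurry U) (W ∩ {z | cylRadius z.2 ≠ 0})) :
    AEStronglyMeasurable (K.indicator (uncurry U)) volume := by
  have hKm : MeasurableSet K := hK.isClosed.measurableSet
  set O : Set (ℝ × EuclideanSpace ℝ (Fin 3)) := W ∩ {z | cylRadius z.2 ≠ 0} with hO
  have hOo : IsOpen O := hW.inter (isOpen_ne_fun (continuous_cylRadius.comp continuous_snd) continuous_const)
  have h1 : AEStronglyMeasurable (uncurry U) (volume.restrict O) := hU.aestronglyMeasurable hOo.measurableSet
  have h2 : AEStronglyMeasurable (uncurry U) (volume.restrict (K ∩ O)) :=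
    h1.mono_measure (Measure.restrict_mono inter_subset_right le_rfl)
  have hae : K =ᵐ[volume] (K ∩ O : Set (ℝ × EuclideanSpace ℝ (Fin 3))) := by
    rw [ae_eq_set]
    constructor
    · refine measure_mono_null (fun z hz => ?_) volume_setOf_cylRadius_snd_eq_zero
      by_contra h
      exact hz.2 ⟨hz.1, hKW hz.1, h⟩
    · exact measure_mono_null (fun z hz => (hz.2 hz.1.1).elim) (measure_empty (μ := volume))
  rw [aestronglyMeasurable_indicator_iff hKm, Measure.restrict_congr_set hae]
  exact h2

/-! ### `1/ϱ` and `‖U‖/ϱ` are locally integrable in space–time -/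

/-- `1/ϱ` is integrable on every compact subset of `ℝ × ℝ³` (a compact set lies in a time
interval times a cylinder box, on which `1/ϱ` integrates by Fubini). [folklore] -/
theorem integrableOn_inv_cylRadius_snd {K : Set (ℝ × EuclideanSpace ℝ (Fin 3))} (hK : IsCompact K) :
    IntegrableOn (fun z : ℝ × EuclideanSpace ℝ (Fin 3) => (cylRadius z.2)⁻¹) K := by
  obtain ⟨R, hR⟩ := hK.isBounded.subset_closedBall 0
  have hKsub : K ⊆ Icc (-R) R ×ˢ solidCylinder R R := by
    intro z hz
    have h := hR hz
    rw [mem_closedBall, dist_zero_right] at h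
    refine ⟨?_, closedBall_subset_solidCylinder R ?_⟩
    · have := (norm_fst_le z).trans h
      rw [Real.norm_eq_abs] at this
      exact mem_Icc.2 (abs_le.1 this)
    · rw [mem_closedBall, dist_zero_right]
      exact (norm_snd_le z).trans h
  have hprod : IntegrableOn (fun z : ℝ × EuclideanSpace ℝ (Fin 3) => (cylRadius z.2)⁻¹) (Icc (-R) R ×ˢ solidCylinder R R) := by
    have h1 : Integrable ((Icc (-R) R).indicator fun _ => (1 : ℝ)) :=
      (integrableOn_const (C := (1 : ℝ)) (by exact measure_Icc_lt_top.ne)).integrable_indicator measurableSet_Icc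
    have h2 : Integrable ((solidCylinder R R).indicator fun x : EuclideanSpace ℝ (Fin 3) => (cylRadius x)⁻¹) :=
      (integrableOn_inv_cylRadius_solidCylinder R R).integrable_indicator (measurableSet_solidCylinder R R)
    have h := h1.mul_prod h2
    rw [← Measure.volume_eq_prod] at h
    refine (integrable_indicator_iff (measurableSet_Icc.prod (measurableSet_solidCylinder R R))).1 ?_
    refine h.congr (Eventually.of_forall fun z => ?_)
    simp only [indicator, mem_prod]
    by_cases ha : z.1 ∈ Icc (-R) R <;> by_cases hb : z.2 ∈ solidCylinder R R <;> simp [ha, hb]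
  exact hprod.mono_set hKsub

/-- **`u ∈ L³(K)` ⟹ `|u|/ϱ ∈ L¹(K)` and `|u| ∈ L¹(K)`** for compact `K ⊆ ℝ × ℝ³`: Hölder with
exponents `(3, 3/2)` and the local integrability of `ϱ^{-3/2}`
(`lintegral_inv_cylRadius_rpow_ball_le` with `q = 3/2 < 2`). [cite: NazarovUraltseva2012, §4, the drift classes b̂ ∈ L_{q,∞,loc}, q<2, and v ∈ L_{q,ℓ}] -/
theorem integrable_norm_div_cylRadius_of_lintegral_cube {K : Set (ℝ × EuclideanSpace ℝ (Fin 3))} (hK : IsCompact K)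
    {U : ℝ → EuclideanSpace ℝ (Fin 3) → EuclideanSpace ℝ (Fin 3)}
    (hUm : AEStronglyMeasurable (K.indicator (uncurry U)) volume)
    (hU3 : ∫⁻ z in K, ‖U z.1 z.2‖ₑ ^ (3 : ℕ) < ∞) :
    Integrable (fun z : ℝ × EuclideanSpace ℝ (Fin 3) => ‖U z.1 z.2‖ / cylRadius z.2) (volume.restrict K) ∧
    Integrable (fun z : ℝ × EuclideanSpace ℝ (Fin 3) => ‖U z.1 z.2‖) (volume.restrict K) := by
  have hKm : MeasurableSet K := hK.isClosed.measurableSet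
  have hUK : AEStronglyMeasurable (uncurry U) (volume.restrict K) := (aestronglyMeasurable_indicator_iff hKm).1 hUm
  -- a box containing `K`
  obtain ⟨R, hR⟩ := hK.isBounded.subset_closedBall 0
  set r : ℝ := |R| + 1 with hr
  have hr0 : 0 < r := by positivity
  have hKsub : K ⊆ Icc (-r) r ×ˢ ball (0 : EuclideanSpace ℝ (Fin 3)) r := by
    intro z hz
    have h := hR hz
    rw [mem_closedBall, dist_zero_right] at h
    have hRr : R < r := by rw [hr]; linarith [le_abs_self R]
    refine ⟨?_, ?_⟩
    · have := (norm_fst_le z).trans h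
      rw [Real.norm_eq_abs] at this
      exact mem_Icc.2 (abs_le.1 (this.trans hRr.le))
    · rw [mem_ball, dist_zero_right]
      exact lt_of_le_of_lt ((norm_snd_le z).trans h) hRr
  have hρle : ∀ z ∈ K, cylRadius z.2 ≤ r := fun z hz => by
    have h := (hKsub hz).2
    rw [mem_ball, dist_zero_right] at h
    exact ((SereginZajaczkowski2007.cylRadius_le_norm' z.2).trans h.le)
  -- the two factors in `ℝ≥0∞`
  set f : ℝ × EuclideanSpace ℝ (Fin 3) → ℝ≥0∞ := fun z => ‖U z.1 z.2‖ₑ with hf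
  set g : ℝ × EuclideanSpace ℝ (Fin 3) → ℝ≥0∞ := fun z => ENNReal.ofReal ((cylRadius z.2)⁻¹) with hg
  have hfm : AEMeasurable f (volume.restrict K) := hUK.enorm
  have hgm : Measurable g := ENNReal.measurable_ofReal.comp (continuous_cylRadius.comp continuous_snd).measurable.inv
  -- `∫_K g^{3/2} < ∞`
  obtain ⟨C, hC⟩ := lintegral_inv_cylRadius_rpow_ball_le (3 / 2) (by norm_num) (by norm_num)
  have hg32 : ∀ z : ℝ × EuclideanSpace ℝ (Fin 3), g z ^ (3 / 2 : ℝ) = ENNReal.ofReal (cylRadius z.2 ^ (-(3 / 2 : ℝ))) := by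
    intro z
    simp only [hg]
    rw [ENNReal.ofReal_rpow_of_nonneg (inv_nonneg.2 (cylRadius_nonneg _)) (by norm_num), Real.inv_rpow (cylRadius_nonneg _),
      Real.rpow_neg (cylRadius_nonneg _)]
  have hgint : ∫⁻ z in K, g z ^ (3 / 2 : ℝ) < ∞ := by
    calc ∫⁻ z in K, g z ^ (3 / 2 : ℝ) ≤ ∫⁻ z in Icc (-r) r ×ˢ ball (0 : EuclideanSpace ℝ (Fin 3)) r, g z ^ (3 / 2 : ℝ) :=
          lintegral_mono_set hKsub
      _ = ∫⁻ z in Icc (-r) r ×ˢ ball (0 : EuclideanSpace ℝ (Fin 3)) r, ENNReal.ofReal (cylRadius z.2 ^ (-(3 / 2 : ℝ))) := by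
          simp_rw [hg32]
      _ = volume (Icc (-r) r) * ∫⁻ x in ball (0 : EuclideanSpace ℝ (Fin 3)) r, ENNReal.ofReal (cylRadius x ^ (-(3 / 2 : ℝ))) := by
          rw [Measure.volume_eq_prod, ← Measure.prod_restrict]
          have hmeas : Measurable fun x : EuclideanSpace ℝ (Fin 3) => ENNReal.ofReal (cylRadius x ^ (-(3 / 2 : ℝ))) :=
            ENNReal.measurable_ofReal.comp (continuous_cylRadius.measurable.pow_const _)
          have h := lintegral_prod_mul (μ := volume.restrict (Icc (-r) r))
            (ν := volume.restrict (ball (0 : EuclideanSpace ℝ (Fin 3)) r)) (f := fun _ => (1 : ℝ≥0∞))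
            (g := fun x => ENNReal.ofReal (cylRadius x ^ (-(3 / 2 : ℝ)))) aemeasurable_const hmeas.aemeasurable
          simp only [one_mul, lintegral_const, Measure.restrict_apply_univ] at h
          exact h
      _ < ∞ := by
          refine ENNReal.mul_lt_top measure_Icc_lt_top ((hC 0 r hr0).trans_lt ?_)
          exact ENNReal.mul_lt_top ENNReal.coe_lt_top ENNReal.ofReal_lt_top
  -- Hölder
  have hpq : (3 : ℝ).HolderConjugate (3 / 2) := Real.holderConjugate_iff.2 ⟨by norm_num, by norm_num⟩
  have hH := ENNReal.lintegral_mul_le_Lp_mul_Lq (volume.restrict K) hpq hfm hgm.aemeasurable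
  have hf3 : ∫⁻ z in K, f z ^ (3 : ℝ) < ∞ := by
    have e : ∀ z, f z ^ (3 : ℝ) = ‖U z.1 z.2‖ₑ ^ (3 : ℕ) := fun z => by
      rw [hf, show (3 : ℝ) = ((3 : ℕ) : ℝ) by norm_num, ENNReal.rpow_natCast]
    simp_rw [e]; exact hU3
  have hfg : ∫⁻ z in K, f z * g z < ∞ := by
    refine lt_of_le_of_lt hH (ENNReal.mul_lt_top ?_ ?_)
    · exact ENNReal.rpow_lt_top_of_nonneg (by norm_num) hf3.ne
    · exact ENNReal.rpow_lt_top_of_nonneg (by norm_num) hgint.ne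
  -- the real integrand `‖U‖/ϱ`
  have hm1 : AEStronglyMeasurable (fun z : ℝ × EuclideanSpace ℝ (Fin 3) => ‖U z.1 z.2‖ / cylRadius z.2) (volume.restrict K) :=
    hUK.norm.mul (continuous_cylRadius.comp continuous_snd).measurable.inv.aestronglyMeasurable
  have hI1 : Integrable (fun z : ℝ × EuclideanSpace ℝ (Fin 3) => ‖U z.1 z.2‖ / cylRadius z.2) (volume.restrict K) := by
    refine ⟨hm1, ?_⟩
    rw [hasFiniteIntegral_iff_enorm]
    refine lt_of_le_of_lt (le_of_eq (lintegral_congr fun z => ?_)) hfg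
    rw [div_eq_mul_inv, enorm_mul, enorm_norm, hf, hg, Real.enorm_eq_ofReal (inv_nonneg.2 (cylRadius_nonneg _))]
  refine ⟨hI1, ?_⟩
  -- `‖U‖ ≤ r ‖U‖/ϱ` a.e. on `K`
  refine Integrable.mono' (hI1.const_mul r) hUK.norm ?_
  rw [ae_restrict_iff' hKm]
  have hae : ∀ᵐ z : ℝ × EuclideanSpace ℝ (Fin 3), cylRadius z.2 ≠ 0 := by
    have h := volume_setOf_cylRadius_snd_eq_zero
    rw [ae_iff]; simpa using h
  filter_upwards [hae] with z hz hzK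
  have hρ : 0 < cylRadius z.2 := lt_of_le_of_ne (cylRadius_nonneg _) (Ne.symm hz)
  rw [norm_norm]
  calc ‖U z.1 z.2‖ = cylRadius z.2 * (‖U z.1 z.2‖ / cylRadius z.2) := by field_simp
    _ ≤ r * (‖U z.1 z.2‖ / cylRadius z.2) :=
        mul_le_mul_of_nonneg_right (hρle z hzK) (div_nonneg (norm_nonneg _) (cylRadius_nonneg _))

/-! ### Integrability of the drift integrands in space–time -/

/-- **`L(z)[U(z)]` is integrable** when `L : ℝ × ℝ³ → (ℝ³ →L ℝ)` is a.e.-strongly measurable,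
bounded, vanishing off a compact `K`, and `‖U‖ ∈ L¹(K)` with `1_K U` measurable (e.g.
`L = Φ Dη`, `U` the drift: the integrand `Φ Dη[U]` of the very weak form). [folklore] -/
theorem integrable_clm_apply_drift {K : Set (ℝ × EuclideanSpace ℝ (Fin 3))} (hK : IsCompact K)
    {L : ℝ × EuclideanSpace ℝ (Fin 3) → EuclideanSpace ℝ (Fin 3) →L[ℝ] ℝ} (hLm : AEStronglyMeasurable L volume)
    {C : ℝ} (hLC : ∀ z, ‖L z‖ ≤ C) (hL0 : ∀ z, z ∉ K → L z = 0)
    {U : ℝ → EuclideanSpace ℝ (Fin 3) → EuclideanSpace ℝ (Fin 3)}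
    (hUm : AEStronglyMeasurable (K.indicator (uncurry U)) volume)
    (hUi : Integrable (fun z : ℝ × EuclideanSpace ℝ (Fin 3) => ‖U z.1 z.2‖) (volume.restrict K)) :
    Integrable (fun z : ℝ × EuclideanSpace ℝ (Fin 3) => L z (U z.1 z.2)) := by
  have hKm : MeasurableSet K := hK.isClosed.measurableSet
  have hC0 : 0 ≤ C := (norm_nonneg _).trans (hLC (0, 0))
  have happ : AEStronglyMeasurable (fun z : ℝ × EuclideanSpace ℝ (Fin 3) => L z (K.indicator (uncurry U) z)) volume :=
    (isBoundedBilinearMap_apply (𝕜 := ℝ) (E := EuclideanSpace ℝ (Fin 3)) (F := ℝ)).continuous.comp_aestronglyMeasurable₂ hLm hUm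
  have hmeas : AEStronglyMeasurable (fun z : ℝ × EuclideanSpace ℝ (Fin 3) => L z (U z.1 z.2)) volume := by
    refine happ.congr (Eventually.of_forall fun z => ?_)
    show L z (K.indicator (uncurry U) z) = L z (U z.1 z.2)
    by_cases hz : z ∈ K
    · rw [indicator_of_mem hz]; rfl
    · rw [hL0 z hz]; rfl
  have hbi : Integrable (K.indicator fun z : ℝ × EuclideanSpace ℝ (Fin 3) => C * ‖U z.1 z.2‖) :=
    (integrable_indicator_iff hKm).2 (hUi.const_mul C)
  refine hbi.mono' hmeas (Eventually.of_forall fun z => ?_)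
  by_cases hz : z ∈ K
  · rw [indicator_of_mem hz]
    exact (L z).le_of_opNorm_le (hLC z) _
  · rw [hL0 z hz, indicator_of_notMem hz]
    simp

/-- **`Φ (2/ϱ) D(z)[e_ϱ]` is integrable** when `1_K Φ` is a.e.-strongly measurable with `|Φ| ≤ M`
on the compact `K`, and `D : ℝ × ℝ³ → (ℝ³ →L ℝ)` is continuous, bounded, vanishing off `K`
(e.g. `D = Dη`: the integrand `Φ (2x'/|x'|²)·∇η` of the very weak form; `1/ϱ ∈ L¹(K)`).
[folklore] -/
theorem integrable_mul_axisDrift_apply {K : Set (ℝ × EuclideanSpace ℝ (Fin 3))} (hK : IsCompact K)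
    {Φ : ℝ × EuclideanSpace ℝ (Fin 3) → ℝ} (hΦm : AEStronglyMeasurable (K.indicator Φ) volume) {M : ℝ}
    (hΦM : ∀ z ∈ K, |Φ z| ≤ M)
    {D : ℝ × EuclideanSpace ℝ (Fin 3) → EuclideanSpace ℝ (Fin 3) →L[ℝ] ℝ} (hD : Continuous D)
    {C : ℝ} (hDC : ∀ z, ‖D z‖ ≤ C) (hD0 : ∀ z, z ∉ K → D z = 0) :
    Integrable (fun z : ℝ × EuclideanSpace ℝ (Fin 3) => Φ z * (2 / cylRadius z.2 * D z (eR z.2))) := by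
  have hKm : MeasurableSet K := hK.isClosed.measurableSet
  have hC0 : 0 ≤ C := (norm_nonneg _).trans (hDC (0, 0))
  have hinv : Measurable fun z : ℝ × EuclideanSpace ℝ (Fin 3) => 2 / cylRadius z.2 :=
    measurable_const.div (continuous_cylRadius.comp continuous_snd).measurable
  have hDe : AEStronglyMeasurable (fun z : ℝ × EuclideanSpace ℝ (Fin 3) => D z (eR z.2)) volume :=
    (isBoundedBilinearMap_apply (𝕜 := ℝ) (E := EuclideanSpace ℝ (Fin 3)) (F := ℝ)).continuous.comp_aestronglyMeasurable₂
      hD.aestronglyMeasurable (measurable_eR.comp measurable_snd).aestronglyMeasurable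
  have hmeas : AEStronglyMeasurable (fun z : ℝ × EuclideanSpace ℝ (Fin 3) => Φ z * (2 / cylRadius z.2 * D z (eR z.2))) volume := by
    refine ((hΦm.mul (hinv.aestronglyMeasurable.mul hDe))).congr (Eventually.of_forall fun z => ?_)
    show K.indicator Φ z * (2 / cylRadius z.2 * D z (eR z.2)) = Φ z * (2 / cylRadius z.2 * D z (eR z.2))
    by_cases hz : z ∈ K
    · rw [indicator_of_mem hz]
    · rw [hD0 z hz]; simp
  have hbi : Integrable (K.indicator fun z : ℝ × EuclideanSpace ℝ (Fin 3) => |M| * (2 * C) * (cylRadius z.2)⁻¹) :=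
    (integrable_indicator_iff hKm).2 ((integrableOn_inv_cylRadius_snd hK).const_mul (|M| * (2 * C)))
  refine hbi.mono' hmeas (Eventually.of_forall fun z => ?_)
  by_cases hz : z ∈ K
  · rw [indicator_of_mem hz, Real.norm_eq_abs, abs_mul, abs_mul, abs_of_nonneg (div_nonneg zero_le_two (cylRadius_nonneg _))]
    have h1 : |Φ z| ≤ |M| := (hΦM z hz).trans (le_abs_self M)
    have h2 : |D z (eR z.2)| ≤ C := by
      refine ((D z).le_of_opNorm_le (hDC z) _).trans ?_
      calc C * ‖eR z.2‖ ≤ C * 1 := mul_le_mul_of_nonneg_left (norm_eR_le_one _) hC0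
        _ = C := mul_one C
    calc |Φ z| * (2 / cylRadius z.2 * |D z (eR z.2)|) ≤ |M| * (2 / cylRadius z.2 * C) :=
          mul_le_mul h1 (mul_le_mul_of_nonneg_left h2 (div_nonneg zero_le_two (cylRadius_nonneg _)))
            (mul_nonneg (div_nonneg zero_le_two (cylRadius_nonneg _)) (abs_nonneg _)) (abs_nonneg _)
      _ = |M| * (2 * C) * (cylRadius z.2)⁻¹ := by ring
  · rw [hD0 z hz, indicator_of_notMem hz]
    simp

/-- **`F (2/ϱ)∂_ϱψ_ε` is integrable** for `F` continuous vanishing off a compact `K` and `ε > 0`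
(`|∂_ϱψ_ε| ≤ 2C_T/ε`, `1/ϱ ∈ L¹(K)`). [folklore] -/
theorem integrable_mul_axisDrift_axisCutoff {K : Set (ℝ × EuclideanSpace ℝ (Fin 3))} (hK : IsCompact K)
    {F : ℝ × EuclideanSpace ℝ (Fin 3) → ℝ} (hF : Continuous F) (hF0 : ∀ z, z ∉ K → F z = 0) {ε : ℝ} (hε : 0 < ε) :
    Integrable (fun z : ℝ × EuclideanSpace ℝ (Fin 3) =>
      F z * (2 / cylRadius z.2 * (deriv Real.smoothTransition (2 / ε * cylRadius z.2 - 1) * (2 / ε)))) := by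
  have hKm : MeasurableSet K := hK.isClosed.measurableSet
  obtain ⟨CT, hCT0, hCT⟩ := LeiZhang2011.exists_abs_deriv_smoothTransition_le
  obtain ⟨M, hM⟩ : ∃ M, ∀ z, |F z| ≤ M := by
    obtain ⟨M, hM⟩ := hF.bounded_above_of_compact_support (HasCompactSupport.intro hK hF0)
    exact ⟨M, fun z => by simpa [Real.norm_eq_abs] using hM z⟩
  have hM0 : 0 ≤ M := (abs_nonneg _).trans (hM (0, 0))
  have hmeas : AEStronglyMeasurable (fun z : ℝ × EuclideanSpace ℝ (Fin 3) =>
      F z * (2 / cylRadius z.2 * (deriv Real.smoothTransition (2 / ε * cylRadius z.2 - 1) * (2 / ε)))) volume := by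
    refine hF.aestronglyMeasurable.mul (Measurable.aestronglyMeasurable ?_)
    exact (measurable_const.div (continuous_cylRadius.comp continuous_snd).measurable).mul
      ((((Real.smoothTransition.contDiff (n := 1)).continuous_deriv le_rfl).measurable.comp
        ((measurable_const.mul (continuous_cylRadius.comp continuous_snd).measurable).sub measurable_const)).mul
        measurable_const)
  have hbi : Integrable (K.indicator fun z : ℝ × EuclideanSpace ℝ (Fin 3) => M * (2 * (CT * (2 / ε))) * (cylRadius z.2)⁻¹) :=
    (integrable_indicator_iff hKm).2 ((integrableOn_inv_cylRadius_snd hK).const_mul _)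
  refine hbi.mono' hmeas (Eventually.of_forall fun z => ?_)
  by_cases hz : z ∈ K
  · rw [indicator_of_mem hz, Real.norm_eq_abs, abs_mul, abs_mul, abs_of_nonneg (div_nonneg zero_le_two (cylRadius_nonneg _)),
      abs_mul, abs_of_nonneg (div_nonneg zero_le_two hε.le)]
    calc |F z| * (2 / cylRadius z.2 * (|deriv Real.smoothTransition (2 / ε * cylRadius z.2 - 1)| * (2 / ε)))
        ≤ M * (2 / cylRadius z.2 * (CT * (2 / ε))) :=
          mul_le_mul (hM z) (mul_le_mul_of_nonneg_left (mul_le_mul_of_nonneg_right (hCT _) (div_nonneg zero_le_two hε.le))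
            (div_nonneg zero_le_two (cylRadius_nonneg _)))
            (mul_nonneg (div_nonneg zero_le_two (cylRadius_nonneg _)) (mul_nonneg (abs_nonneg _) (div_nonneg zero_le_two hε.le))) hM0
      _ = M * (2 * (CT * (2 / ε))) * (cylRadius z.2)⁻¹ := by ring
  · rw [hF0 z hz, indicator_of_notMem hz]
    simp

/-! ### The commutator of the drift with the axis cut-off -/

/-- **The drift–cut-off commutator vanishes in the limit.** Let `K ⊆ ℝ × ℝ³` be compact,
`G : ℝ × ℝ³ → ℝ` a.e.-strongly measurable with `|G| ≤ M` and `G = 0` off `K`, and `U` with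
`1_K U` a.e.-strongly measurable and `‖U‖/ϱ ∈ L¹(K)`. Then, with the axis cut-off
`ψ_ε(x) = sT((2/ε)ϱ(x) - 1)`, `∫∫ G · Dψ_ε[U] dx dt → 0` as `ε → 0⁺`: dominated convergence with
the `ε`-uniform majorant `M · (2C_T/ϱ)‖U‖ · 1_K` (`|Dψ_ε[v]| ≤ (2C_T/ϱ)‖v‖`) and `Dψ_ε(x) = 0`
for `ε < ϱ(x)`. With `G = Φη` this is the term `∫∫ Φ η U·∇ψ_ε` (the would-be boundary term
`∫_{ϱ=ε} Φ η u·n dσ`) of the derivation of Seregin's displayed inequality.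
[cite: Seregin2020, proof of Lemma 2.2 (arXiv p. 8); NazarovUraltseva2012 (4.5)] -/
theorem tendsto_integral_driftCommutator : ∀ {K : Set (ℝ × EuclideanSpace ℝ (Fin 3))}, IsCompact K →
    ∀ {G : ℝ × EuclideanSpace ℝ (Fin 3) → ℝ}, AEStronglyMeasurable G volume → ∀ {M : ℝ}, (∀ z, |G z| ≤ M) →
    (∀ z, z ∉ K → G z = 0) →
    ∀ {U : ℝ → EuclideanSpace ℝ (Fin 3) → EuclideanSpace ℝ (Fin 3)}, AEStronglyMeasurable (K.indicator (uncurry U)) volume →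
    Integrable (fun z : ℝ × EuclideanSpace ℝ (Fin 3) => ‖U z.1 z.2‖ / cylRadius z.2) (volume.restrict K) →
    ∀ {φ : ℝ → EuclideanSpace ℝ (Fin 3) → ℝ}, (∀ ε x, φ ε x = Real.smoothTransition (2 / ε * cylRadius x - 1)) →
    Tendsto (fun ε : ℝ => ∫ z : ℝ × EuclideanSpace ℝ (Fin 3), G z * fderiv ℝ (φ ε) z.2 (U z.1 z.2)) (𝓝[>] 0) (𝓝 0) := by
  intro K hK G hGm M hGM hG0 U hUm hUi φ hφ
  have hKm : MeasurableSet K := hK.isClosed.measurableSet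
  have hM0 : 0 ≤ M := (abs_nonneg _).trans (hGM (0, 0))
  obtain ⟨CT, hCT0, hCT⟩ := LeiZhang2011.exists_abs_deriv_smoothTransition_le
  -- the majorant
  set b : ℝ × EuclideanSpace ℝ (Fin 3) → ℝ := K.indicator fun z => M * (2 * CT) * (‖U z.1 z.2‖ / cylRadius z.2) with hb
  have hbi : Integrable b := (integrable_indicator_iff hKm).2 (hUi.const_mul (M * (2 * CT)))
  have hev : ∀ᶠ ε in 𝓝[>] (0 : ℝ), 0 < ε := self_mem_nhdsWithin
  suffices key : Tendsto (fun ε : ℝ => ∫ z : ℝ × EuclideanSpace ℝ (Fin 3), G z * fderiv ℝ (φ ε) z.2 (U z.1 z.2)) (𝓝[>] 0)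
      (𝓝 (∫ _ : ℝ × EuclideanSpace ℝ (Fin 3), (fun _ => (0 : ℝ)) ())) by simpa using key
  refine tendsto_integral_filter_of_dominated_convergence b ?_ ?_ hbi ?_
  · -- measurability
    filter_upwards [hev] with ε hε
    obtain ⟨hsmooth, -⟩ := axisCutoff_props hε hCT (hφ ε)
    have hcD : Continuous fun z : ℝ × EuclideanSpace ℝ (Fin 3) => fderiv ℝ (φ ε) z.2 :=
      (hsmooth.continuous_fderiv (by simp)).comp continuous_snd
    have happ : AEStronglyMeasurable (fun z : ℝ × EuclideanSpace ℝ (Fin 3) =>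
        fderiv ℝ (φ ε) z.2 (K.indicator (uncurry U) z)) volume :=
      (isBoundedBilinearMap_apply (𝕜 := ℝ) (E := EuclideanSpace ℝ (Fin 3)) (F := ℝ)).continuous.comp_aestronglyMeasurable₂
        hcD.aestronglyMeasurable hUm
    refine (hGm.mul happ).congr (Eventually.of_forall fun z => ?_)
    show G z * fderiv ℝ (φ ε) z.2 (K.indicator (uncurry U) z) = G z * fderiv ℝ (φ ε) z.2 (U z.1 z.2)
    by_cases hz : z ∈ K
    · rw [indicator_of_mem hz]; rfl
    · rw [hG0 z hz, zero_mul, zero_mul]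
  · -- the bound
    filter_upwards [hev] with ε hε
    refine Eventually.of_forall fun z => ?_
    by_cases hz : z ∈ K
    · rw [hb, indicator_of_mem hz, Real.norm_eq_abs, abs_mul]
      calc |G z| * |fderiv ℝ (φ ε) z.2 (U z.1 z.2)| ≤ M * (2 * CT / cylRadius z.2 * ‖U z.1 z.2‖) :=
            mul_le_mul (hGM z) (abs_fderiv_axisCutoff_apply_le hε hCT (hφ ε) z.2 (U z.1 z.2)) (abs_nonneg _) hM0
        _ = M * (2 * CT) * (‖U z.1 z.2‖ / cylRadius z.2) := by ring
    · rw [hG0 z hz, zero_mul, norm_zero, hb, indicator_of_notMem hz]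
  · -- pointwise limit `0` off the axis
    have hae : ∀ᵐ z : ℝ × EuclideanSpace ℝ (Fin 3), cylRadius z.2 ≠ 0 := by
      have h := volume_setOf_cylRadius_snd_eq_zero
      rw [ae_iff]; simpa using h
    filter_upwards [hae] with z hz
    refine (tendsto_const_nhds (x := (0 : ℝ))).congr' ?_
    filter_upwards [fderiv_axisCutoff_eventuallyEq_zero hφ hz] with ε hε
    rw [hε]; simp

end Summit.NavierStokesRegularity.NavierStokesRegularity.Theorems.AxisymmetricKatoGlobal.EulerScaling

end
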